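import Literature.MathematicalPhysics.QuantumFieldTheory.Balaban1983to89.T4G183StripRate
import Literature.MathematicalPhysics.QuantumFieldTheory.Balaban1983to89.T4Hk163RatePair
import Literature.MathematicalPhysics.QuantumFieldTheory.Balaban1983to89.B5G183FreeDecay

/-!
# G183KernelRates — the (1.83) propagator `G = Δ_1⁻¹` at `U = 1` in the cell's kernel-rate currencies: the COVARIANT
# REGULAR PART satisfies the shared η-rate hypothesis `T4RateAlgebra.RatePair` (θ = L⁻¹); the TWO-LEG-FINE FREE PART
# does NOT (kernel witness: its coincident-point value grows like `n^{d−1}`), and its η-rate is TYPED — not proved — in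
# King's scale-covariant pointwise currency (the one remaining `U = 1` linear-theory gap of cell object X9)

Tree target `Summits/QuantumFields/BalabanUV/T4Continuum/Support/` (LEAN PLACEMENT RULE 2026-08-19: new cell work under `Summits/`,
published results only under `Literature/`).  Cell `pub-balaban`, T4-DAG §5 node U1a, spine estimate NE2 (η-rate of the one-step
LINEAR operators), prover P2 (strip/Fourier technique), lineage t4-ne2-p2 gen 7, row T4-U1a.E-NE2-PROVE-P2g*; imports BY NAME only.

HONEST FRAMING (page 1).  Rung (B)+1 bookkeeping for the LINEAR theory at background `U = 1`, on the unit lattice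
`ℤ^{d+1}` / the infinite fine lattice; NOT infinite-volume physics, NOT a mass gap, NOT Clay, NOT summit progress.  The cell
conditionals BetaPertH, (B), (B^μ) do not occur.  Nothing printed in the audited papers is used as a hypothesis; no
`def … : Prop` of this file is assumed anywhere — §3's shapes are STATEMENTS OF WHAT IS MISSING, typed for the carver.

WHAT IS PROVED (kernel; Mathlib + the imports by name; no `sorry`, no new axiom).
§1 REGULAR PART — for the family `k ↦ Re K^{(L^k)}_{00;μν}(x)` of unit-lattice kernels (`B4ContourShift.latticeKernel`) of
  pv15's covariant fine-offset multiplier `B5G183CovDecay.Mcov (L^k) N μ ν 0 0` (the (1.83) double alias sum MINUS its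
  resolvent-expanded massive free diagonal, order `N ≥ d + 1`, read between coarse base points): `ratePair_kerGFamily` —
  `RatePair (kerGFamily L N μ ν) (MD183(d+1,N)) (κ₁₈₃(d+1)/(d+1)) (C183e(d+1,N)) (L⁻¹)`, i.e. (UD) `k`-uniform decay
  (`B5G183CovDecay.latticeKernel_Mcov_decay`) AND (PR′) the one-step bound `C183e·L^{−k}·e^{−δ|x|₁}` (this lineage's
  `T4G183StripRate.latticeKernel_Mcov_rate`, gen 6); readings `unitStepIneq_kerGFamily` (T4 `UnitStepIneq`),
  `uniformDecay_and_stepRate_kerGMatrix`, `kernelInputs183` (β socket `Beta.LimitRate.KernelInputs`, `L ≥ 2`, `μ ≠ ν` —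
  CAVEAT as in `T4Hk163RatePair`: NOT the one-loop kernel `Π⁰`, no β-function statement), `exists_ratePair_183` — the
  (1.83) analogue of gen 2's `T4GaugeActionRatePair` ((1.66)) and gen 5's `T4Hk163RatePair` ((1.63)).
§2 FREE PART, THE LOCATED OBSTRUCTION — `freeKer n N x₀ := n^{d+1}·K[freeMult n N](x₀)`: the PHYSICALLY normalised kernel of
  `Σ_{j<N}(−Δ^{1/n} + 1)^{−(j+1)}` on the fine lattice `(1/n)ℤ^{d+1}` (pv15's `B5G183FreeDecay.freeMult`; normalisation = the
  one in which the regular part above is `O(1)`: `B5G183KernelDecay.DeltaA_one_inv_bpt_eq` writes the fine-torus matrix element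
  of `Δ_1⁻¹` as `[free resolvent polynomial] + n^{−(d+1)}·[torus kernel of Mcov]`).  Kernel facts: the real-momentum symbol is
  real with `0 ≤ Δ ≤ 4(d+1)n²` (`fineSym_ofRealVec`), hence `Re freeMult ≥ 1/(4(d+1)n²+1)` (`re_freeMult_ofRealVec_ge`),
  hence `Re K[freeMult n N](0) ≥ 1/(4(d+1)n²+1)` (`re_latticeKernel_freeMult_zero_ge`, a Bochner-integral lower bound over
  the Brillouin zone) and `Re freeKer n N 0 ≥ n/(4(d+1)+1)` for `d ≥ 2` (`re_freeKer_zero_ge`): the coincident-point value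
  of the free part is UNBOUNDED in `n` (`freeKerFamily_zero_unbounded`).  Consequently the family
  `freeKerFamily L N k x := Re freeKer (L^k) N (L^k•x)` (the free part between the SAME coarse base points as §1) admits NO
  `k`-uniform (5.10)-decay bound and NO `RatePair` with any constants (`not_uniformDecay_freeKerFamily`,
  `not_ratePair_freeKerFamily`, `d ≥ 2`, `L ≥ 2`, `N ≥ 1`).  READING: the n-uniform strip/kernel currency of this lineage
  (`StripRegular` amplitude uniform in `n` ⇒ `Decay510` uniform in `k` ⇒ `RatePair`) — in which X8 (1.66), X10 (1.63),
  X11 (2.156) and X9's regular part now have η-rates in the tree — CANNOT host the two-leg-fine free part of X9; this is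
  the `η^{2−d}` coincidence singularity of B5 (1.110), not a defect of the estimates.
§3 FREE PART, THE MISSING INEQUALITY TYPED — `FreePartRateShape d N γ C δ` / `FreePartRate d N`: for fine levels `n ≤ m`
  and a common fine point `x ≠ 0` (`x′·n = x·m`), `‖freeKer m N x′ − freeKer n N x‖ ≤ C·n^{−γ}·(|x|_∞/n)^{2−(d+1)−γ}·e^{−δ|x|_∞/n}`
  — King's single-scale rate (3.73) summed over the scales of (2.17) (`Σ_j L^{−γk}(L^jη)^{2−d−γ}e^{−δ₀|x−y|/(L^jη)} ≍
  η^γ|x−y|^{2−d−γ}`; the loss `(|x|/η)^{−γ}` is `T4EtaRate.rateFactor` at the lattice-scale site).  A [shape]: NOT proved, NOT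
  a hypothesis of any theorem here; `freePartRateShape_offDiag` records only that ON THE COARSE POINTS `x = n•y`, `y ≠ 0`, it
  is a (PR′)-type bound with `θ = L^{−γ}` (so §2's obstruction sits exactly at `y = 0`, and the shape's extra content is the
  scale-covariant gain at fine separations).  Its proof is a lattice-Green's-function asymptotics theorem (King: (2.17) +
  Prop. 3.8; classically: dyadic oscillatory-integral bounds for `∫e^{ip·x}(Δ_n(p)+1)^{−1}dp`, `x ≠ 0`) — outside this seat's
  strip/contour-shift technique, absent from the tree and Mathlib; its printed consumer is perturbative power counting
  (King p. 665 «Redoing the analysis, we see that the degrees of some subgraphs have been reduced by γ»), i.e. the cell's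
  BetaPertH sector — the non-perturbative spine nodes consume the block-averaged objects X8/X10/X11/X9-regular.
NOT COVERED.  `U ≠ 1` (NE2⁺: no momentum representation); the torus version of §2; whether `UnitStepIneq` ALONE fails for
the free family (needs the sharp upper bound `Re K(0) ≍ n^{−2}`, i.e. `∫dq/Δ(q) < ∞`); any proof of §3.

SOURCES (locations and method sentences only; nothing printed is a hypothesis).  T. Bałaban, *Propagators and
renormalization transformations for lattice gauge theories. I*, Commun. Math. Phys. **95**, 17–40 (1984)
[Balaban1984PropagatorsI] = cell paper B5: (1.83) p. 31, Prop. 1.2 (1.110)–(1.115) p. 35, p. 38 «the analyticity method of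
proving an exponential decay» (the printed bounds are uniform `O(1)` bounds, no η-rate: the cell's located gap).  C. King,
*The U(1) Higgs model. I. The continuum limit*, Commun. Math. Phys. **102**, 649–677 (1986) [King1986] (PUBLISHED, outside
the audited series): (2.17) p. 653, Prop. 3.8 (3.71) p. 664, Prop. 3.9 (3.73)–(3.75) p. 665, proof pp. 674–676 (read by this
seat as OCR text `lit read paper-king1986-cmp102-king-u1-higgs-i` pp. 5, 16–17, 26–28 and as page images p016/p017).  What is
reproduced: NOTHING of either paper's mathematics — §1 is bookkeeping over the imports, §2 a positivity computation, §3 a statement.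
-/

noncomputable section

open Complex MeasureTheory Set

namespace Summit.QuantumFields.BalabanUV.T4Continuum.G183KernelRates

open Literature.MathematicalPhysics.QuantumFieldTheory.Balaban1983to89
open B4Strip (ofRealVec)
open B4ContourShift (latticeKernel supNorm BZ integrand phase fourierBox)
open B5G183Strip (kappa183 kappa183_pos)
open B5G183CovSplit (resolv)
open B5G183CovDecay (Mcov MD183 MD183_nonneg latticeKernel_Mcov_decay)
open B5G183FreeDecay (freeMult fineSym fineSym_eq stripRegular_freeMult rOf_div_pos rOf_div_admissible)
open T4G183StripRate (C183e C183e_nonneg latticeKernel_Mcov_rate)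
open B12Sec2to5 (l1 Decay510)
open T4RateAlgebra (RatePair step_apply UnitStepIneq unitStepIneq_iff ratePair_iff_uniformDecay_and_stepRate
  kernelInputsOfRatePair)
open T4GaugeActionRatePair (exp_sup_le_exp_l1 theta_lt_one theta_nonneg)

variable {d : ℕ}

/-! ## §1 The covariant regular part of (1.83) satisfies `RatePair` (θ = L⁻¹) -/

/-- `Re K^{(n)}_{00;μν}(x)`: real part of the unit-lattice kernel of the covariant fine-offset multiplier `Mcov n N μ ν 0 0`
(both fine offsets `0`: the entries between coarse base points). [folklore] -/
def kerG (n : ℕ) [NeZero n] (N : ℕ) (μ ν : Fin (d + 1)) (x : Fin (d + 1) → ℤ) : ℝ :=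
  (latticeKernel (fun p : Fin (d + 1) → ℂ => Mcov n N μ ν (fun _ => (0 : Fin n)) (fun _ => (0 : Fin n)) p) x).re

/-- (UD) for the regular part, every `n ≥ 1`, `N ≥ d`: `|Re K^{(n)}(x)| ≤ MD183(d+1,N)·e^{−(κ₁₈₃(d+1)/(d+1))|x|₁}`
(`latticeKernel_Mcov_decay` + sup-to-`ℓ¹`). [folklore] -/
theorem kerG_decay (n : ℕ) [NeZero n] {N : ℕ} (hN : d + 1 ≤ N + 1) (μ ν : Fin (d + 1)) :
    Decay510 (kerG (d := d) n N μ ν) (MD183 (d + 1) N) (kappa183 (d + 1) / ((d : ℝ) + 1)) := by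
  intro x
  have h1 := latticeKernel_Mcov_decay (d := d) n hN μ ν (fun _ => (0 : Fin n)) (fun _ => (0 : Fin n)) x
  have h2 := exp_sup_le_exp_l1 (d := d) (kappa183_pos (d + 1)).le x
  unfold kerG
  exact (abs_re_le_norm _).trans (h1.trans (mul_le_mul_of_nonneg_left h2 (MD183_nonneg _ _)))

/-- the two-level bound (`latticeKernel_Mcov_rate` at the physical fine offsets `(0,0)`): for `1 ≤ n ≤ m`, `N ≥ d + 1`,
`|Re K^{(m)}(x) − Re K^{(n)}(x)| ≤ C183e(d+1,N)/n · e^{−(κ₁₈₃(d+1)/(d+1))|x|₁}`. [folklore] -/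
theorem kerG_step {n m : ℕ} [NeZero n] [NeZero m] (hn : 1 ≤ n) (hnm : n ≤ m) {N : ℕ} (hN : d + 1 ≤ N)
    (μ ν : Fin (d + 1)) (x : Fin (d + 1) → ℤ) :
    |kerG m N μ ν x - kerG n N μ ν x|
      ≤ C183e (d + 1) N / n * Real.exp (-(kappa183 (d + 1) / ((d : ℝ) + 1)) * l1 x) := by
  have hr := latticeKernel_Mcov_rate (d := d) hn hnm hN μ ν (fun _ => (0 : Fin n)) (fun _ => (0 : Fin n))
    (fun _ => (0 : Fin m)) (fun _ => (0 : Fin m)) (fun _ => by simp) (fun _ => by simp) x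
  have h2 := exp_sup_le_exp_l1 (d := d) (kappa183_pos (d + 1)).le x
  have hC : 0 ≤ C183e (d + 1) N / n := by have := C183e_nonneg (d + 1) N; positivity
  rw [kerG, kerG, ← Complex.sub_re]
  exact (abs_re_le_norm _).trans (hr.trans (mul_le_mul_of_nonneg_left h2 hC))

/-- the scale-indexed family `X_k(x) = Re K^{(L^k)}_{00;μν}(x)` of the (1.83) regular part. [folklore] -/
def kerGFamily (L : ℕ) [NeZero L] (N : ℕ) (μ ν : Fin (d + 1)) : ℕ → (Fin (d + 1) → ℤ) → ℝ :=
  fun k x => kerG (L ^ k) N μ ν x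

/-- **RATE PAIR FOR THE REGULAR PART OF (1.83) AT `U = 1`**: for `L ≥ 1`, `N ≥ d + 1`, `μ`, `ν`,
`RatePair (kerGFamily L N μ ν) (MD183(d+1,N)) (κ₁₈₃(d+1)/(d+1)) (C183e(d+1,N)) (L⁻¹)`. [folklore] -/
theorem ratePair_kerGFamily (L : ℕ) [NeZero L] {N : ℕ} (hN : d + 1 ≤ N) (μ ν : Fin (d + 1)) :
    RatePair (kerGFamily (d := d) L N μ ν) (MD183 (d + 1) N) (kappa183 (d + 1) / ((d : ℝ) + 1)) (C183e (d + 1) N)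
      ((L : ℝ)⁻¹) where
  decay k := kerG_decay (d := d) (L ^ k) (Nat.le_succ_of_le hN) μ ν
  rate k := by
    intro x
    have hL : 1 ≤ L := Nat.one_le_iff_ne_zero.mpr (NeZero.ne L)
    have h := kerG_step (d := d) (n := L ^ k) (m := L ^ (k + 1)) (Nat.one_le_pow _ _ hL)
      (Nat.pow_le_pow_right hL (Nat.le_succ k)) hN μ ν x
    have e : C183e (d + 1) N / (((L ^ k : ℕ) : ℝ)) = C183e (d + 1) N * ((L : ℝ)⁻¹) ^ k := by
      rw [Nat.cast_pow, inv_pow, div_eq_mul_inv]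
    rw [e] at h
    rw [step_apply]
    exact h

/-- T4 reading: `UnitStepIneq` for the regular part, `B₀ = C183e(d+1,N)`, `δ₀ = κ₁₈₃(d+1)/(d+1)`, `θ = L⁻¹`. [folklore] -/
theorem unitStepIneq_kerGFamily (L : ℕ) [NeZero L] {N : ℕ} (hN : d + 1 ≤ N) (μ ν : Fin (d + 1)) :
    UnitStepIneq (kerGFamily (d := d) L N μ ν) (C183e (d + 1) N) (kappa183 (d + 1) / ((d : ℝ) + 1)) ((L : ℝ)⁻¹) :=
  (unitStepIneq_iff _ _ _ _).mpr (ratePair_kerGFamily L hN μ ν).rate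

/-- the same kernels packaged β-style (matrix indices = the vector indices `(μ, ν)`).  NOT the one-loop kernel `Π⁰`.
[folklore] -/
def kerGMatrix (L : ℕ) [NeZero L] (N : ℕ) : ℕ → B12Beta.Kernel (d + 1) :=
  fun k μ ν x => kerG (L ^ k) N μ ν x

/-- β reading: `UniformDecay ∧ StepRate` of every `(μ, ν)` component of `kerGMatrix L N`. [folklore] -/
theorem uniformDecay_and_stepRate_kerGMatrix (L : ℕ) [NeZero L] {N : ℕ} (hN : d + 1 ≤ N) (μ ν : Fin (d + 1)) :
    Beta.LimitRate.UniformDecay (kerGMatrix (d := d) L N) μ ν (MD183 (d + 1) N) (kappa183 (d + 1) / ((d : ℝ) + 1)) ∧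
      Beta.LimitRate.StepRate (kerGMatrix (d := d) L N) μ ν (C183e (d + 1) N) (kappa183 (d + 1) / ((d : ℝ) + 1))
        ((L : ℝ)⁻¹) :=
  (ratePair_iff_uniformDecay_and_stepRate (kerGMatrix L N) μ ν _ _ _ _).mp (ratePair_kerGFamily L hN μ ν)

/-- `0 < κ₁₈₃(d+1)/(d+1)`. [folklore] -/
theorem delta183_pos (d : ℕ) : 0 < kappa183 (d + 1) / ((d : ℝ) + 1) := by
  have := kappa183_pos (d + 1); positivity

/-- for `L ≥ 2`, `N ≥ d + 1` and `μ ≠ ν`, the β socket `Beta.LimitRate.KernelInputs (d+1) (kerGMatrix L N)` is inhabited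
(`T4RateAlgebra.kernelInputsOfRatePair`).  CAVEAT: `kerGMatrix` is NOT `Π⁰`; no one-loop dictionary is supplied. [folklore] -/
def kernelInputs183 (L : ℕ) [NeZero L] (hL : 2 ≤ L) {N : ℕ} (hN : d + 1 ≤ N) {μ ν : Fin (d + 1)} (hμ : μ ≠ ν) :
    Beta.LimitRate.KernelInputs (d + 1) (kerGMatrix (d := d) L N) :=
  kernelInputsOfRatePair hμ (delta183_pos d) (theta_nonneg L) (theta_lt_one hL) (ratePair_kerGFamily L hN μ ν)

/-- summary in the consumers' quantifier shape. [folklore] -/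
theorem exists_ratePair_183 (L : ℕ) [NeZero L] (hL : 2 ≤ L) {N : ℕ} (hN : d + 1 ≤ N) (μ ν : Fin (d + 1)) :
    ∃ C δ C' θ : ℝ, 0 < δ ∧ 0 ≤ θ ∧ θ < 1 ∧ RatePair (kerGFamily (d := d) L N μ ν) C δ C' θ :=
  ⟨_, _, _, _, delta183_pos d, theta_nonneg L, theta_lt_one hL, ratePair_kerGFamily L hN μ ν⟩

/-! ## §2 The two-leg-fine free part: physically normalised kernel, coincident-point growth, no `RatePair` -/

/-- `freeKer n N x₀ := n^{d+1} · K[freeMult n N](x₀)`: the physically normalised kernel of `Σ_{j<N}(−Δ^{1/n}+1)^{−(j+1)}`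
at the fine lattice point `x₀/n`, `x₀ ∈ ℤ^{d+1}`. [folklore] -/
def freeKer (n : ℕ) [NeZero n] (N : ℕ) (x₀ : Fin (d + 1) → ℤ) : ℂ :=
  (n : ℂ) ^ (d + 1) * latticeKernel (fun q : Fin (d + 1) → ℂ => freeMult n N q) x₀

/-- the real-momentum symbol: `fineSym n p = Σ_μ n²(2 − 2cos p_μ)` is real … [folklore] -/
theorem fineSym_ofRealVec (n : ℕ) [NeZero n] (p : Fin (d + 1) → ℝ) :
    fineSym n (ofRealVec p) = ((∑ μ, (n : ℝ) ^ 2 * (2 - 2 * Real.cos (p μ)) : ℝ) : ℂ) := by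
  rw [fineSym_eq]
  push_cast
  simp [ofRealVec]

/-- … nonnegative and at most `4(d+1)n²`. [folklore] -/
theorem fineSymReal_bounds (n : ℕ) (p : Fin (d + 1) → ℝ) :
    0 ≤ ∑ μ, (n : ℝ) ^ 2 * (2 - 2 * Real.cos (p μ)) ∧
      ∑ μ, (n : ℝ) ^ 2 * (2 - 2 * Real.cos (p μ)) ≤ 4 * ((d : ℝ) + 1) * (n : ℝ) ^ 2 := by
  constructor
  · exact Finset.sum_nonneg fun μ _ => by nlinarith [Real.cos_le_one (p μ), sq_nonneg (n : ℝ)]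
  · calc ∑ μ, (n : ℝ) ^ 2 * (2 - 2 * Real.cos (p μ)) ≤ ∑ _μ : Fin (d + 1), 4 * (n : ℝ) ^ 2 :=
          Finset.sum_le_sum fun μ _ => by nlinarith [Real.neg_one_le_cos (p μ), sq_nonneg (n : ℝ)]
      _ = 4 * ((d : ℝ) + 1) * (n : ℝ) ^ 2 := by
          rw [Finset.sum_const, Finset.card_univ, Fintype.card_fin]; ring

/-- the resolvent polynomial at a real argument is real: `R_N(s) = Σ_{j<N}(s+1)^{−(j+1)}`. [folklore] -/
theorem resolv_ofReal (N : ℕ) (s : ℝ) :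
    resolv N (s : ℂ) = ((∑ j ∈ Finset.range N, 1 / (s + 1) ^ (j + 1) : ℝ) : ℂ) := by
  unfold resolv; push_cast; rfl

/-- `Re freeMult n N (p) ≥ 1/(4(d+1)n² + 1)` at every REAL momentum, `N ≥ 1` (the `j = 0` term alone). [folklore] -/
theorem re_freeMult_ofRealVec_ge (n : ℕ) [NeZero n] {N : ℕ} (hN : 1 ≤ N) (p : Fin (d + 1) → ℝ) :
    1 / (4 * ((d : ℝ) + 1) * (n : ℝ) ^ 2 + 1) ≤ (freeMult n N (ofRealVec p)).re := by
  obtain ⟨h0, h4⟩ := fineSymReal_bounds (d := d) n p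
  set s : ℝ := ∑ μ, (n : ℝ) ^ 2 * (2 - 2 * Real.cos (p μ)) with hs
  have hfs : freeMult n N (ofRealVec p) = ((∑ j ∈ Finset.range N, 1 / (s + 1) ^ (j + 1) : ℝ) : ℂ) := by
    unfold freeMult; rw [fineSym_ofRealVec, ← hs, resolv_ofReal]
  rw [hfs, Complex.ofReal_re]
  have hterm : ∀ j ∈ Finset.range N, 0 ≤ 1 / (s + 1) ^ (j + 1) := fun j _ => by positivity
  have h0N : 0 ∈ Finset.range N := Finset.mem_range.mpr hN
  calc 1 / (4 * ((d : ℝ) + 1) * (n : ℝ) ^ 2 + 1) ≤ 1 / (s + 1) :=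
        one_div_le_one_div_of_le (by positivity) (by linarith)
    _ = 1 / (s + 1) ^ (0 + 1) := by rw [zero_add, pow_one]
    _ ≤ ∑ j ∈ Finset.range N, 1 / (s + 1) ^ (j + 1) := Finset.single_le_sum hterm h0N

/-- **the coincident-point lower bound of the lattice kernel**: `Re K[freeMult n N](0) ≥ 1/(4(d+1)n²+1)` — the Brillouin-zone
average of a function whose real part is at least that. [folklore] -/
theorem re_latticeKernel_freeMult_zero_ge (n : ℕ) [NeZero n] {N : ℕ} (hN : 1 ≤ N) :
    1 / (4 * ((d : ℝ) + 1) * (n : ℝ) ^ 2 + 1) ≤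
      (latticeKernel (fun q : Fin (d + 1) → ℂ => freeMult n N q) 0).re := by
  set c : ℝ := 1 / (4 * ((d : ℝ) + 1) * (n : ℝ) ^ 2 + 1) with hc
  set G : (Fin (d + 1) → ℂ) → ℂ := fun q => freeMult n N q with hG
  have hInt0 : IntegrableOn (integrand G 0) (BZ (d + 1)) :=
    (stripRegular_freeMult (d := d) n (rOf_div_pos n d).le (rOf_div_admissible n d) N).integrableOn
      (rOf_div_pos n d).le 0
  have hphase : ∀ p : Fin (d + 1) → ℝ, integrand G 0 p = G (ofRealVec p) := by
    intro p; simp [integrand, phase]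
  have hInt : IntegrableOn (fun p : Fin (d + 1) → ℝ => G (ofRealVec p)) (BZ (d + 1)) :=
    hInt0.congr_fun (fun p _ => hphase p) (by unfold BZ; exact measurableSet_Icc)
  have hre : (∫ p in BZ (d + 1), G (ofRealVec p)).re = ∫ p in BZ (d + 1), (G (ofRealVec p)).re := by
    have h := integral_re hInt
    simpa using h.symm
  have hvol : (volume (BZ (d + 1))).toReal = (2 * Real.pi) ^ (d + 1) := by
    unfold BZ
    rw [Real.volume_Icc_pi_toReal (fun _ => by linarith [Real.pi_pos])]
    simp [Finset.prod_const]; ring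
  have hconst : IntegrableOn (fun _ : Fin (d + 1) → ℝ => c) (BZ (d + 1)) := by
    unfold BZ; exact continuousOn_const.integrableOn_compact isCompact_Icc
  have hmono : ∫ p in BZ (d + 1), c ≤ ∫ p in BZ (d + 1), (G (ofRealVec p)).re :=
    setIntegral_mono hconst hInt.re fun p => re_freeMult_ofRealVec_ge (d := d) n hN p
  have hcI : ∫ _p in BZ (d + 1), c = (2 * Real.pi) ^ (d + 1) * c := by
    rw [setIntegral_const, smul_eq_mul, show volume.real (BZ (d + 1)) = (volume (BZ (d + 1))).toReal from rfl, hvol]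
  have hK : (latticeKernel G 0).re = ((2 * Real.pi) ^ (d + 1))⁻¹ * (∫ p in BZ (d + 1), G (ofRealVec p)).re := by
    unfold latticeKernel fourierBox
    rw [Complex.smul_re, smul_eq_mul]
    congr 2
    exact setIntegral_congr_fun (by unfold BZ; exact measurableSet_Icc) fun p _ => hphase p
  have hpos : 0 < ((2 * Real.pi) ^ (d + 1))⁻¹ := by positivity
  rw [hK, hre]
  calc c = ((2 * Real.pi) ^ (d + 1))⁻¹ * ((2 * Real.pi) ^ (d + 1) * c) := by
        rw [← mul_assoc, inv_mul_cancel₀ (by positivity), one_mul]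
    _ ≤ ((2 * Real.pi) ^ (d + 1))⁻¹ * ∫ p in BZ (d + 1), (G (ofRealVec p)).re := by
        rw [← hcI]; exact mul_le_mul_of_nonneg_left hmono hpos.le

/-- … hence `Re freeKer n N 0 ≥ n^{d+1}/(4(d+1)n²+1)`. [folklore] -/
theorem re_freeKer_zero_ge' (n : ℕ) [NeZero n] {N : ℕ} (hN : 1 ≤ N) :
    (n : ℝ) ^ (d + 1) / (4 * ((d : ℝ) + 1) * (n : ℝ) ^ 2 + 1) ≤ (freeKer (d := d) n N 0).re := by
  have h := re_latticeKernel_freeMult_zero_ge (d := d) n hN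
  have e : freeKer (d := d) n N 0 =
      (((n : ℝ) ^ (d + 1) : ℝ) : ℂ) * latticeKernel (fun q : Fin (d + 1) → ℂ => freeMult n N q) 0 := by
    unfold freeKer; push_cast; rfl
  rw [e, Complex.re_ofReal_mul, div_eq_mul_one_div]
  exact mul_le_mul_of_nonneg_left h (by positivity)

/-- **COINCIDENT-POINT GROWTH**: for `d ≥ 2` (space-time dimension `d + 1 ≥ 3`), `N ≥ 1`, every `n ≥ 1`:
`Re freeKer n N 0 ≥ n/(4(d+1)+1)` — the physically normalised free part at coinciding fine points grows at least
linearly in `n = η⁻¹` (in truth like `n^{d−1}`; B5 (1.110): `O(η^{2−d})`). [folklore] -/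
theorem re_freeKer_zero_ge (hd : 2 ≤ d) (n : ℕ) [NeZero n] {N : ℕ} (hN : 1 ≤ N) :
    (n : ℝ) / (4 * ((d : ℝ) + 1) + 1) ≤ (freeKer (d := d) n N 0).re := by
  refine le_trans ?_ (re_freeKer_zero_ge' (d := d) n hN)
  have hn : (1 : ℝ) ≤ n := by exact_mod_cast Nat.one_le_iff_ne_zero.mpr (NeZero.ne n)
  have hD : (0 : ℝ) < 4 * ((d : ℝ) + 1) + 1 := by positivity
  rw [div_le_div_iff₀ hD (by positivity)]
  have h3 : (n : ℝ) ^ 3 ≤ (n : ℝ) ^ (d + 1) := pow_le_pow_right₀ hn (by omega)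
  have h1 : (n : ℝ) ≤ (n : ℝ) ^ (d + 1) := le_self_pow₀ hn (by omega)
  nlinarith [h3, h1, sq_nonneg (n : ℝ)]

/-- the free part read between the SAME coarse base points as §1's family: `k ↦ Re freeKer (L^k) N (L^k • x)`
(fine index of the coarse offset `x` at level `n = L^k` is `n•x`). [folklore] -/
def freeKerFamily (L : ℕ) [NeZero L] (N : ℕ) : ℕ → (Fin (d + 1) → ℤ) → ℝ :=
  fun k x => (freeKer (d := d) (L ^ k) N (((L ^ k : ℕ) : ℤ) • x)).re

/-- `freeKerFamily L N k 0 ≥ L^k/(4(d+1)+1)`. [folklore] -/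
theorem freeKerFamily_zero_ge (hd : 2 ≤ d) (L : ℕ) [NeZero L] {N : ℕ} (hN : 1 ≤ N) (k : ℕ) :
    ((L : ℝ) ^ k) / (4 * ((d : ℝ) + 1) + 1) ≤ freeKerFamily (d := d) L N k 0 := by
  have h := re_freeKer_zero_ge (d := d) hd (L ^ k) hN
  rw [Nat.cast_pow] at h
  simpa [freeKerFamily] using h

/-- **UNBOUNDEDNESS**: for `d ≥ 2`, `L ≥ 2`, `N ≥ 1`, the coincident-point values `freeKerFamily L N k 0` exceed every
bound. [folklore] -/
theorem freeKerFamily_zero_unbounded (hd : 2 ≤ d) {L : ℕ} [NeZero L] (hL : 2 ≤ L) {N : ℕ} (hN : 1 ≤ N) (A : ℝ) :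
    ∃ k, A < freeKerFamily (d := d) L N k 0 := by
  have hL' : (1 : ℝ) < L := by exact_mod_cast hL
  obtain ⟨k, hk⟩ := pow_unbounded_of_one_lt (A * (4 * ((d : ℝ) + 1) + 1)) hL'
  refine ⟨k, lt_of_lt_of_le ?_ (freeKerFamily_zero_ge (d := d) hd L hN k)⟩
  have hD : (0 : ℝ) < 4 * ((d : ℝ) + 1) + 1 := by positivity
  rwa [lt_div_iff₀ hD]

/-- **NO `k`-UNIFORM (5.10)-DECAY BOUND** for the free family: for `d ≥ 2`, `L ≥ 2`, `N ≥ 1` and ANY constants `C, δ`,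
`¬ ∀ k, Decay510 (freeKerFamily L N k) C δ`. [folklore] -/
theorem not_uniformDecay_freeKerFamily (hd : 2 ≤ d) {L : ℕ} [NeZero L] (hL : 2 ≤ L) {N : ℕ} (hN : 1 ≤ N)
    (C δ : ℝ) : ¬ ∀ k, Decay510 (freeKerFamily (d := d) L N k) C δ := by
  intro h
  obtain ⟨k, hk⟩ := freeKerFamily_zero_unbounded (d := d) hd hL hN C
  have hb := h k 0
  have hl1 : l1 (0 : Fin (d + 1) → ℤ) = 0 := by simp [l1]
  rw [hl1, mul_zero, Real.exp_zero, mul_one] at hb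
  exact absurd (lt_of_lt_of_le hk (le_abs_self _)) (not_lt.mpr hb)

/-- **NO `RatePair` FOR THE TWO-LEG-FINE FREE PART**: for `d ≥ 2`, `L ≥ 2`, `N ≥ 1` and ANY constants `C, δ, C′, θ`,
`¬ RatePair (freeKerFamily L N) C δ C′ θ` — the shared η-rate currency of §1 / `T4GaugeActionRatePair` / `T4Hk163RatePair`
cannot host the free part of X9. [folklore] -/
theorem not_ratePair_freeKerFamily (hd : 2 ≤ d) {L : ℕ} [NeZero L] (hL : 2 ≤ L) {N : ℕ} (hN : 1 ≤ N)
    (C δ C' θ : ℝ) : ¬ RatePair (freeKerFamily (d := d) L N) C δ C' θ :=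
  fun h => not_uniformDecay_freeKerFamily (d := d) hd hL hN C δ h.decay

/-! ## §3 The missing inequality, typed (King's scale-covariant pointwise currency) — a [shape], NOT proved, NOT used -/

/-- [shape] **THE η-RATE OF THE FREE PART OF X9 AT `U = 1`, King (3.73)-currency summed over scales**: for fine levels
`n ≤ m`, every fine point `x ≠ 0` of level `n` and its copy `x′` at level `m` (`x′·n = x·m` componentwise),
`‖freeKer m N x′ − freeKer n N x‖ ≤ C · n^{−γ} · (|x|_∞/n)^{2−(d+1)−γ} · e^{−δ|x|_∞/n}`.  NOT proved here; NOT a hypothesis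
of any theorem of this file. -/
def FreePartRateShape (d N : ℕ) (γ C δ : ℝ) : Prop :=
  ∀ (n m : ℕ) [NeZero n] [NeZero m], n ≤ m →
    ∀ x x' : Fin (d + 1) → ℤ, x ≠ 0 → (∀ i, x' i * n = x i * m) →
      ‖freeKer (d := d) m N x' - freeKer (d := d) n N x‖ ≤
        C * (n : ℝ) ^ (-γ) * (supNorm x / n) ^ (1 - (d : ℝ) - γ) * Real.exp (-(δ * (supNorm x / n)))

/-- [shape] the located gap of X9 at `U = 1`: SOME exponent `γ > 0`, decay rate `δ > 0` and constant `C` realise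
`FreePartRateShape d N γ C δ`. NOT proved here; NOT used. -/
def FreePartRate (d N : ℕ) : Prop := ∃ γ C δ : ℝ, 0 < γ ∧ 0 < δ ∧ FreePartRateShape d N γ C δ

/-- CONSISTENCY WITH §1/§2 (bookkeeping only): ON THE COARSE POINTS `x = L^k • y`, `y ≠ 0`, the shape is a (PR′)-type
one-step bound with geometric factor `θ^k`, `θ = L^{−γ}`, and `k`-independent profile `C·e^{−δ|y|_∞}` — so the obstruction
of §2 is confined to the diagonal `y = 0` (and the shape's extra content is the scale-covariant gain at fine separations).
[folklore] -/
theorem freePartRateShape_offDiag (hd : 1 ≤ d) {N : ℕ} {γ C δ : ℝ} (hγ : 0 ≤ γ) (hC : 0 ≤ C)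
    (h : FreePartRateShape d N γ C δ) (L : ℕ) [NeZero L] (k : ℕ) (y : Fin (d + 1) → ℤ) (hy : y ≠ 0) :
    |freeKerFamily (d := d) L N (k + 1) y - freeKerFamily (d := d) L N k y| ≤
      C * (((L : ℝ) ^ (-γ)) ^ k) * Real.exp (-(δ * supNorm y)) := by
  have hL : 1 ≤ L := Nat.one_le_iff_ne_zero.mpr (NeZero.ne L)
  have hLpos : (0 : ℝ) < L := by exact_mod_cast hL
  set n : ℕ := L ^ k with hn
  set m : ℕ := L ^ (k + 1) with hm
  have hnm : n ≤ m := Nat.pow_le_pow_right hL (Nat.le_succ k)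
  have hx : ((n : ℕ) : ℤ) • y ≠ 0 := by
    intro h0
    apply hy
    have hn0 : ((n : ℕ) : ℤ) ≠ 0 := by exact_mod_cast (NeZero.ne n)
    exact (smul_eq_zero.mp h0).resolve_left hn0
  have hxx : ∀ i, (((m : ℕ) : ℤ) • y) i * n = (((n : ℕ) : ℤ) • y) i * m := by
    intro i; simp only [Pi.smul_apply, smul_eq_mul]; ring
  have hb := h n m hnm (((n : ℕ) : ℤ) • y) (((m : ℕ) : ℤ) • y) hx hxx
  -- `|n•y|_∞ / n = |y|_∞`
  have hnpos : (0 : ℝ) < n := by rw [hn]; exact_mod_cast pow_pos hL k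
  have habs : ∀ i, ((|(((n : ℕ) : ℤ) • y) i| : ℤ) : ℝ) = (n : ℝ) * ((|y i| : ℤ) : ℝ) := by
    intro i; simp only [Pi.smul_apply, smul_eq_mul, abs_mul, Int.cast_mul, Int.cast_abs, Int.cast_natCast]
    rw [abs_of_nonneg hnpos.le]
  have hsup : supNorm (((n : ℕ) : ℤ) • y) / n = supNorm y := by
    rw [div_eq_iff hnpos.ne', mul_comm]
    unfold supNorm
    refine le_antisymm (Finset.sup'_le _ _ fun i _ => ?_) ?_
    · rw [habs]
      exact mul_le_mul_of_nonneg_left (Finset.le_sup' (fun i => ((|y i| : ℤ) : ℝ)) (Finset.mem_univ i)) hnpos.le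
    · obtain ⟨i, -, hi⟩ := Finset.exists_mem_eq_sup' Finset.univ_nonempty (fun i => ((|y i| : ℤ) : ℝ))
      rw [hi, ← habs]
      exact Finset.le_sup' (fun i => ((|(((n : ℕ) : ℤ) • y) i| : ℤ) : ℝ)) (Finset.mem_univ i)
  have hy1 : (1 : ℝ) ≤ supNorm y := by
    obtain ⟨i, hi⟩ : ∃ i, y i ≠ 0 := by
      by_contra hall
      exact hy (funext fun i => not_not.mp (not_exists.mp hall i))
    unfold supNorm
    refine le_trans ?_ (Finset.le_sup' (fun i => ((|y i| : ℤ) : ℝ)) (Finset.mem_univ i))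
    exact_mod_cast Int.one_le_abs hi
  have hd1 : (1 : ℝ) ≤ d := by exact_mod_cast hd
  have hpow : (supNorm y) ^ (1 - (d : ℝ) - γ) ≤ 1 :=
    Real.rpow_le_one_of_one_le_of_nonpos hy1 (by linarith)
  have hpow0 : 0 ≤ (supNorm y) ^ (1 - (d : ℝ) - γ) := Real.rpow_nonneg (by linarith) _
  have hθ : ((n : ℕ) : ℝ) ^ (-γ) = ((L : ℝ) ^ (-γ)) ^ k := by
    rw [hn, Nat.cast_pow, ← Real.rpow_natCast ((L : ℝ) ^ (-γ)) k, ← Real.rpow_mul hLpos.le,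
      mul_comm, Real.rpow_mul hLpos.le, Real.rpow_natCast]
  rw [hsup, hθ] at hb
  have hre : |freeKerFamily (d := d) L N (k + 1) y - freeKerFamily (d := d) L N k y| ≤
      ‖freeKer (d := d) m N (((m : ℕ) : ℤ) • y) - freeKer (d := d) n N (((n : ℕ) : ℤ) • y)‖ := by
    simp only [freeKerFamily, ← hn, ← hm, ← Complex.sub_re]
    exact abs_re_le_norm _
  refine hre.trans (hb.trans ?_)
  have hA : 0 ≤ C * ((L : ℝ) ^ (-γ)) ^ k := mul_nonneg hC (pow_nonneg (Real.rpow_nonneg hLpos.le _) k)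
  calc C * ((L : ℝ) ^ (-γ)) ^ k * supNorm y ^ (1 - (d : ℝ) - γ) * Real.exp (-(δ * supNorm y))
      ≤ C * ((L : ℝ) ^ (-γ)) ^ k * 1 * Real.exp (-(δ * supNorm y)) := by
        gcongr
    _ = C * ((L : ℝ) ^ (-γ)) ^ k * Real.exp (-(δ * supNorm y)) := by rw [mul_one]

end Summit.QuantumFields.BalabanUV.T4Continuum.G183KernelRates

end
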